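import Summits.QuantumFields.BalabanUV.Beta.GAN24.StencilSlotLamDrift
import Literature.MathematicalPhysics.QuantumFieldTheory.Balaban1983to89.Beta.SecondOrderResponse

/-!
# `BalabanUV.Beta.GAN24.WSlotCarrierSub` — binder row G-an2-4 / (CONV-C), W-slot, Cauchy half, part 1: DIFFERENCE IDENTITIES for an2's
# second-order carriers (`vertexOfK`, `vertexOfM`, `dM`) — the telescoping of the weighted superpositions under absolute convergence

NOT IN PRINT; OUR PROOF ATTEMPT (G-an2-4 formalisation swarm, idle leaf seat `b2b-balaban-gan24-formalise-leaf-07`, gen 11; module name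
PROVISIONAL).  HONEST FRAMING (cell contract, verbatim): «discharging `BetaPertH` makes Bałaban's UV stability UNCONDITIONAL — a real
constructive-QFT result; it is NOT the continuum limit and NOT the Clay problem.»  HONEST DEPENDENCY (verbatim): «continuum YM on T⁴ ⇐
BetaPertH ∧ nine spine estimates (0/9 proved); BetaPertH ⇐ (D1) ∧ (D4) ∧ CAP+tail; G-an2-4 gates asym, D1 and NE2/3/4.»
[folklore] bookkeeping toward the W-slot's CAUCHY half `hWall` (the one-step / all-scales rate of an2's normalised second-order family
`unitW (sfStep Lc j) (smStep d Lc j) (WbalOf … j) = W2SymOfK (K̃_j) Lc (S̃_j) (M̃) (T̃_j) (M̃₂)`, `SecondOrderUnits.unitW_WbalOf`; the multiplier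
and mixed tables are `j`-FREE by `WSlotOfShapes.unitM_M1_eq` / `unitM₂_M2Of_eq`, so only THREE slots move: the kernel `K`, the first field
table `S`, the bi-stencil table `S₂`).  A Lipschitz estimate of `W2SymOfK` in those three slots needs the carriers to be ADDITIVE slot by
slot; they are `tsum`-superpositions (`OneStepResolventKernel.wsum`, `InterLevelTransport.cwsum`), so additivity is an identity UNDER
SUMMABILITY.  This part supplies: two summability criteria for the weighted-superposition terms (self-centred families with bounded weights;
families centred at a FIXED point with constants decaying in the index), and the telescoping identities
`vertexOfK K N T − vertexOfK K′ N T′ = vertexOfK (K − K′) N T + vertexOfK K′ N (T − T′)`, `vertexOfM K N Q − vertexOfM K′ N Q = vertexOfM (K − K′) N Q`,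
`dM K N S M − dM K′ N S′ M = dM (K − K′) N S M + vertexOfK K′ N (S − S′)` under the natural decay / locality hypotheses.  No estimate beyond
summability, no cited fact, no `def`, no `Prop` mirror.  Companion of asym1's `HessKerRate` §6 (`wsum_sub_wsum`, `vertexFamily_vertexOfK_sub`)
and of gan24-p1's `StencilSlotLamDrift.cwsum_sub`; nothing of theirs restated.  NOTHING of the wall is discharged.  NOT summit progress.
-/

noncomputable section

open Literature.MathematicalPhysics.QuantumFieldTheory
open Literature.MathematicalPhysics.QuantumFieldTheory.Balaban1983to89
open Literature.MathematicalPhysics.QuantumFieldTheory.Balaban1983to89.Beta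
open Literature.Probability.LatticeModels (Torus.proj)
open LatticeForm (quo)
open B12Sec2to5 (l1 l1_nonneg)
open ExpKernelCalculus (MKer Decays BiLoc VertexFamily Zl summable_exp_shift summable_exp_shift' l1_sub_symm)
open OneStepResolventKernel (Fib LocStencil wsum summable_wsumTerm eq_zsmul_quo_of_proj)
open OneStepKernelFamily (colH vertexOfK abs_colH_le)
open InterLevelTransport (cwsum onLat onLat_off)
open SecondOrderResponse (colM vertexOfM dM abs_colM_le LocStencilFM)
open Summit.QuantumFields.BalabanUV.Beta.GAN24.StencilSlotLamDrift (onLat_weight_bound onLat_biLoc)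

namespace Summit.QuantumFields.BalabanUV.Beta.GAN24.WSlotCarrierSub

variable {d : ℕ} {N : ℕ}

/-! ## §1 Summability of the superposition terms -/

/-- [folklore] SELF-CENTRED FAMILIES, BOUNDED WEIGHTS: `u ↦ w u · T u x z a b` is summable when `|w u| ≤ Cw` and every `T u` is bi-localised
at its own index `u` with one constant `Ck` and a rate `δ > 0` (majorant `Cw·Ck·e^{−δ|x−u|₁}`). -/
theorem summable_wsumTerm_bdd {w : (Fin (d + 1) → ℤ) → ℝ} {T : (Fin (d + 1) → ℤ) → MKer (d + 1) (Fib d)} {Cw Ck δ : ℝ}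
    (hw : ∀ u, |w u| ≤ Cw) (hT : ∀ u, BiLoc (T u) u u Ck δ) (hδ : 0 < δ) (x z : Fin (d + 1) → ℤ) (a b : Fib d) :
    Summable fun u : Fin (d + 1) → ℤ => w u * T u x z a b := by
  have hCw : 0 ≤ Cw := (abs_nonneg _).trans (hw 0)
  have hCk : 0 ≤ Ck := (hT 0).nonneg (Sum.inl 0)
  refine Summable.of_norm_bounded ((summable_exp_shift hδ x).mul_left (Cw * Ck)) (fun u => ?_)
  rw [Real.norm_eq_abs, abs_mul]
  have h2 := hT u x z a b
  have hexp : Real.exp (-δ * (l1 (x - u) + l1 (z - u))) ≤ Real.exp (-δ * l1 (x - u)) :=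
    Real.exp_le_exp.2 (by nlinarith [l1_nonneg (z - u), hδ.le])
  calc |w u| * |T u x z a b| ≤ Cw * (Ck * Real.exp (-δ * (l1 (x - u) + l1 (z - u)))) :=
        mul_le_mul (hw u) h2 (abs_nonneg _) hCw
    _ ≤ Cw * (Ck * Real.exp (-δ * l1 (x - u))) := by gcongr
    _ = Cw * Ck * Real.exp (-δ * l1 (x - u)) := by ring

/-- [folklore] FAMILIES CENTRED AT A FIXED POINT WITH DECAYING CONSTANTS, BOUNDED WEIGHTS: `u ↦ w u · T u x z a b` is summable when
`|w u| ≤ Cw` and every `T u` is bi-localised at `(p, p)` with constant `Ck·e^{−δ|u−p|₁}` (`δ > 0`; the own rate `δ′ ≥ 0` is not used). -/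
theorem summable_wsumTerm_ctr {w : (Fin (d + 1) → ℤ) → ℝ} {T : (Fin (d + 1) → ℤ) → MKer (d + 1) (Fib d)} {Cw Ck δ δ' : ℝ}
    {p : Fin (d + 1) → ℤ} (hw : ∀ u, |w u| ≤ Cw) (hT : ∀ u, BiLoc (T u) p p (Ck * Real.exp (-δ * l1 (u - p))) δ') (hδ : 0 < δ)
    (hδ' : 0 ≤ δ') (hCk : 0 ≤ Ck) (x z : Fin (d + 1) → ℤ) (a b : Fib d) :
    Summable fun u : Fin (d + 1) → ℤ => w u * T u x z a b := by
  have hCw : 0 ≤ Cw := (abs_nonneg _).trans (hw 0)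
  refine Summable.of_norm_bounded ((summable_exp_shift' hδ p).mul_left (Cw * Ck)) (fun u => ?_)
  rw [Real.norm_eq_abs, abs_mul]
  have h2 := hT u x z a b
  have hexp : Real.exp (-δ' * (l1 (x - p) + l1 (z - p))) ≤ 1 :=
    Real.exp_le_one_iff.2 (by nlinarith [l1_nonneg (x - p), l1_nonneg (z - p)])
  calc |w u| * |T u x z a b| ≤ Cw * (Ck * Real.exp (-δ * l1 (u - p)) * Real.exp (-δ' * (l1 (x - p) + l1 (z - p)))) :=
        mul_le_mul (hw u) h2 (abs_nonneg _) hCw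
    _ ≤ Cw * (Ck * Real.exp (-δ * l1 (u - p)) * 1) := by gcongr
    _ = Cw * Ck * Real.exp (-δ * l1 (u - p)) := by ring

/-- [folklore] The field rows of the `(μ, y)`-column of a DECAYING kernel are bounded by its constant. -/
theorem abs_colH_le_const {K : MKer (d + 1) (Fib d)} {C δ : ℝ} (hK : Decays K C δ) (hδ : 0 ≤ δ) (μ : Fin (d + 1))
    (y : Fin (d + 1) → ℤ) (κ : Fin (d + 1)) (u : Fin (d + 1) → ℤ) : |colH K N μ y κ u| ≤ C := by
  have hC : 0 ≤ C := hK.nonneg (Sum.inl 0)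
  refine (abs_colH_le (N := N) hK μ y κ u).trans ?_
  have hexp : Real.exp (-δ * l1 (u - (N : ℤ) • y)) ≤ 1 := Real.exp_le_one_iff.2 (by nlinarith [l1_nonneg (u - (N : ℤ) • y)])
  calc C * Real.exp (-δ * l1 (u - (N : ℤ) • y)) ≤ C * 1 := by gcongr
    _ = C := mul_one C

/-- [folklore] The field rows of the `(μ, y)`-column of a kernel BI-LOCALISED at `(q, q)` are bounded by its constant. -/
theorem abs_colH_le_const_of_biLoc {K : MKer (d + 1) (Fib d)} {q : Fin (d + 1) → ℤ} {C δ : ℝ} (hK : BiLoc K q q C δ) (hδ : 0 ≤ δ)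
    (μ : Fin (d + 1)) (y : Fin (d + 1) → ℤ) (κ : Fin (d + 1)) (u : Fin (d + 1) → ℤ) : |colH K N μ y κ u| ≤ C := by
  have hC : 0 ≤ C := hK.nonneg (Sum.inl 0)
  have h := hK u ((N : ℤ) • y) (Sum.inl κ) (Sum.inr μ)
  have hexp : Real.exp (-δ * (l1 (u - q) + l1 ((N : ℤ) • y - q))) ≤ 1 :=
    Real.exp_le_one_iff.2 (by nlinarith [l1_nonneg (u - q), l1_nonneg ((N : ℤ) • y - q)])
  calc |colH K N μ y κ u| = |K u ((N : ℤ) • y) (Sum.inl κ) (Sum.inr μ)| := rfl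
    _ ≤ C * Real.exp (-δ * (l1 (u - q) + l1 ((N : ℤ) • y - q))) := h
    _ ≤ C * 1 := by gcongr
    _ = C := mul_one C

/-- [folklore] The multiplier rows of the `(μ, y)`-column of a decaying kernel are bounded by its constant (read through `onLat`). -/
theorem abs_onLat_colM_le_const [NeZero N] {K : MKer (d + 1) (Fib d)} {C δ : ℝ} (hK : Decays K C δ) (hδ : 0 ≤ δ) (μ : Fin (d + 1))
    (y : Fin (d + 1) → ℤ) (ρ : Fin (d + 1)) (v : Fin (d + 1) → ℤ) : |onLat N (colM K N μ y ρ) v| ≤ C := by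
  have hC : 0 ≤ C := hK.nonneg (Sum.inl 0)
  by_cases hv : Torus.proj N v = 0
  · simp only [onLat, hv, if_true]
    refine (abs_colM_le (N := N) hK μ y ρ (quo N v)).trans ?_
    have hexp : Real.exp (-δ * l1 ((N : ℤ) • quo N v - (N : ℤ) • y)) ≤ 1 :=
      Real.exp_le_one_iff.2 (by nlinarith [l1_nonneg ((N : ℤ) • quo N v - (N : ℤ) • y)])
    calc C * Real.exp (-δ * l1 ((N : ℤ) • quo N v - (N : ℤ) • y)) ≤ C * 1 := by gcongr
      _ = C := mul_one C
  · rw [onLat_off _ hv, abs_zero]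
    exact hC

/-- [folklore] The multiplier rows of the `(μ, y)`-column of a kernel bi-localised at `(q, q)` are bounded by its constant (through `onLat`). -/
theorem abs_onLat_colM_le_const_of_biLoc [NeZero N] {K : MKer (d + 1) (Fib d)} {q : Fin (d + 1) → ℤ} {C δ : ℝ}
    (hK : BiLoc K q q C δ) (hδ : 0 ≤ δ) (μ : Fin (d + 1)) (y : Fin (d + 1) → ℤ) (ρ : Fin (d + 1)) (v : Fin (d + 1) → ℤ) :
    |onLat N (colM K N μ y ρ) v| ≤ C := by
  have hC : 0 ≤ C := hK.nonneg (Sum.inl 0)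
  by_cases hv : Torus.proj N v = 0
  · simp only [onLat, hv, if_true]
    have h := hK ((N : ℤ) • quo N v) ((N : ℤ) • y) (Sum.inr ρ) (Sum.inr μ)
    have hexp : Real.exp (-δ * (l1 ((N : ℤ) • quo N v - q) + l1 ((N : ℤ) • y - q))) ≤ 1 :=
      Real.exp_le_one_iff.2 (by nlinarith [l1_nonneg ((N : ℤ) • quo N v - q), l1_nonneg ((N : ℤ) • y - q)])
    calc |colM K N μ y ρ (quo N v)| = |K ((N : ℤ) • quo N v) ((N : ℤ) • y) (Sum.inr ρ) (Sum.inr μ)| := rfl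
      _ ≤ C * Real.exp (-δ * (l1 ((N : ℤ) • quo N v - q) + l1 ((N : ℤ) • y - q))) := h
      _ ≤ C * 1 := by gcongr
      _ = C := mul_one C
  · rw [onLat_off _ hv, abs_zero]
    exact hC

/-- [folklore] A local FIELD–MULTIPLIER table read through `onLat` in its coarse slot: centred at the fine bond `u`, constant decaying in
the index (`v = N•w` on the sublattice, zero off it). -/
theorem onLat_biLoc_ctr [NeZero N] {Q : (Fin (d + 1) → ℤ) → MKer (d + 1) (Fib d)} {u : Fin (d + 1) → ℤ} {C δ : ℝ}
    (hQ : ∀ w, BiLoc (Q w) u u (C * Real.exp (-δ * l1 (u - (N : ℤ) • w))) δ) (hC : 0 ≤ C) (v : Fin (d + 1) → ℤ) :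
    BiLoc (onLat N Q v) u u (C * Real.exp (-δ * l1 (v - u))) δ := by
  by_cases hv : Torus.proj N v = 0
  · have e := eq_zsmul_quo_of_proj (N := N) hv
    simp only [onLat, hv, if_true]
    have h := hQ (quo N v)
    rw [← e, l1_sub_symm] at h
    exact h
  · intro x z a b
    rw [onLat_off Q hv]
    show |(0 : ℝ)| ≤ _
    rw [abs_zero]
    positivity

/-! ## §2 The telescoping identities -/

/-- [folklore] **TELESCOPING OF WEIGHTED SUPERPOSITIONS, ENTRYWISE, UNDER SUMMABILITY**:
`wsum w T − wsum w′ T′ = wsum (w − w′) T + wsum w′ (T − T′)` at one entry, given the three summabilities. -/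
theorem wsum_sub_wsum_of_summable {w w' : (Fin (d + 1) → ℤ) → ℝ} {T T' : (Fin (d + 1) → ℤ) → MKer (d + 1) (Fib d)}
    {x z : Fin (d + 1) → ℤ} {a b : Fib d} (h1 : Summable fun u => w u * T u x z a b) (h2 : Summable fun u => w' u * T u x z a b)
    (h3 : Summable fun u => w' u * T' u x z a b) :
    wsum w T x z a b - wsum w' T' x z a b = wsum (w - w') T x z a b + wsum w' (T - T') x z a b := by
  simp only [wsum, Pi.sub_apply]
  have e1 : (fun u => (w u - w' u) * T u x z a b) = fun u => w u * T u x z a b - w' u * T u x z a b :=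
    funext fun u => by ring
  have e2 : (fun u => w' u * (T u x z a b - T' u x z a b)) = fun u => w' u * T u x z a b - w' u * T' u x z a b :=
    funext fun u => by ring
  rw [e1, e2, h1.tsum_sub h2, h2.tsum_sub h3]
  ring

/-- [folklore] The `ℋ`-column is linear in the kernel, as a weight family: `colH K − colH K′ = colH (K − K′)`. -/
theorem colH_sub_fun (K K' : MKer (d + 1) (Fib d)) (N : ℕ) (μ : Fin (d + 1)) (y : Fin (d + 1) → ℤ) (κ : Fin (d + 1)) :
    colH K N μ y κ - colH K' N μ y κ = colH (K - K') N μ y κ := by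
  funext u
  simp [colH]

/-- [folklore] **THE CHAIN-RULE VERTEX TELESCOPES IN (KERNEL, TABLE), UNDER SUMMABILITY**:
`vertexOfK K N T μ y − vertexOfK K′ N T′ μ y = vertexOfK (K − K′) N T μ y + vertexOfK K′ N (T − T′) μ y`. -/
theorem vertexOfK_sub_vertexOfK {K K' : MKer (d + 1) (Fib d)} {T T' : Fin (d + 1) → (Fin (d + 1) → ℤ) → MKer (d + 1) (Fib d)}
    {μ : Fin (d + 1)} {y : Fin (d + 1) → ℤ}
    (h1 : ∀ κ x z a b, Summable fun u => colH K N μ y κ u * T κ u x z a b)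
    (h2 : ∀ κ x z a b, Summable fun u => colH K' N μ y κ u * T κ u x z a b)
    (h3 : ∀ κ x z a b, Summable fun u => colH K' N μ y κ u * T' κ u x z a b) :
    vertexOfK K N T μ y - vertexOfK K' N T' μ y = vertexOfK (K - K') N T μ y + vertexOfK K' N (T - T') μ y := by
  funext x z a b
  simp only [vertexOfK, Pi.sub_apply, Pi.add_apply]
  rw [← Finset.sum_sub_distrib, ← Finset.sum_add_distrib]
  refine Finset.sum_congr rfl fun κ _ => ?_
  rw [wsum_sub_wsum_of_summable (h1 κ x z a b) (h2 κ x z a b) (h3 κ x z a b), colH_sub_fun]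

/-- [folklore] **THE CHAIN-RULE VERTEX TELESCOPES** — decaying kernels, local stencil tables (the summabilities discharged):
`vertexOfK K N S μ y − vertexOfK K′ N S′ μ y = vertexOfK (K − K′) N S μ y + vertexOfK K′ N (S − S′) μ y`. -/
theorem vertexOfK_sub_of_decays {K K' : MKer (d + 1) (Fib d)} {C C' δK : ℝ} (hK : Decays K C δK) (hK' : Decays K' C' δK)
    (hδK : 0 ≤ δK) {S S' : Fin (d + 1) → (Fin (d + 1) → ℤ) → MKer (d + 1) (Fib d)} {Cs Cs' δ : ℝ} (hS : LocStencil S Cs δ)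
    (hS' : LocStencil S' Cs' δ) (hδ : 0 < δ) (μ : Fin (d + 1)) (y : Fin (d + 1) → ℤ) :
    vertexOfK K N S μ y - vertexOfK K' N S' μ y = vertexOfK (K - K') N S μ y + vertexOfK K' N (S - S') μ y :=
  vertexOfK_sub_vertexOfK
    (fun κ x z a b => summable_wsumTerm_bdd (fun u => abs_colH_le_const (N := N) hK hδK μ y κ u) (fun u => hS κ u) hδ x z a b)
    (fun κ x z a b => summable_wsumTerm_bdd (fun u => abs_colH_le_const (N := N) hK' hδK μ y κ u) (fun u => hS κ u) hδ x z a b)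
    (fun κ x z a b => summable_wsumTerm_bdd (fun u => abs_colH_le_const (N := N) hK' hδK μ y κ u) (fun u => hS' κ u) hδ x z a b)

/-- [folklore] **THE CHAIN-RULE VERTEX TELESCOPES** — kernels BI-LOCALISED at coarse points (the second-response kernels `K2OfK … ν y′`),
local stencil tables. -/
theorem vertexOfK_sub_of_biLoc {K K' : MKer (d + 1) (Fib d)} {q q' : Fin (d + 1) → ℤ} {C C' δK : ℝ} (hK : BiLoc K q q C δK)
    (hK' : BiLoc K' q' q' C' δK) (hδK : 0 ≤ δK) {S S' : Fin (d + 1) → (Fin (d + 1) → ℤ) → MKer (d + 1) (Fib d)} {Cs Cs' δ : ℝ}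
    (hS : LocStencil S Cs δ) (hS' : LocStencil S' Cs' δ) (hδ : 0 < δ) (μ : Fin (d + 1)) (y : Fin (d + 1) → ℤ) :
    vertexOfK K N S μ y - vertexOfK K' N S' μ y = vertexOfK (K - K') N S μ y + vertexOfK K' N (S - S') μ y :=
  vertexOfK_sub_vertexOfK
    (fun κ x z a b => summable_wsumTerm_bdd (fun u => abs_colH_le_const_of_biLoc (N := N) hK hδK μ y κ u) (fun u => hS κ u) hδ x z a b)
    (fun κ x z a b => summable_wsumTerm_bdd (fun u => abs_colH_le_const_of_biLoc (N := N) hK' hδK μ y κ u) (fun u => hS κ u) hδ x z a b)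
    (fun κ x z a b => summable_wsumTerm_bdd (fun u => abs_colH_le_const_of_biLoc (N := N) hK' hδK μ y κ u) (fun u => hS' κ u) hδ x z a b)

/-- [folklore] **THE OUTER CHAIN-RULE VERTEX OVER INNER SLICES TELESCOPES** — decaying kernels, inner families bi-localised at their own
fine bond with constants decaying away from a coarse point (the slices of a bi-vertex / mixed bi-vertex): the uniform constants `B, B′`
bound the far-decaying ones, so the terms are summable. -/
theorem vertexOfK_sub_of_slices {K K' : MKer (d + 1) (Fib d)} {C C' δK : ℝ} (hK : Decays K C δK) (hK' : Decays K' C' δK)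
    (hδK : 0 ≤ δK) {T T' : Fin (d + 1) → (Fin (d + 1) → ℤ) → MKer (d + 1) (Fib d)} {B B' δ : ℝ}
    (hT : ∀ κ u, BiLoc (T κ u) u u B δ) (hT' : ∀ κ u, BiLoc (T' κ u) u u B' δ) (hδ : 0 < δ) (μ : Fin (d + 1)) (y : Fin (d + 1) → ℤ) :
    vertexOfK K N T μ y - vertexOfK K' N T' μ y = vertexOfK (K - K') N T μ y + vertexOfK K' N (T - T') μ y :=
  vertexOfK_sub_vertexOfK
    (fun κ x z a b => summable_wsumTerm_bdd (fun u => abs_colH_le_const (N := N) hK hδK μ y κ u) (fun u => hT κ u) hδ x z a b)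
    (fun κ x z a b => summable_wsumTerm_bdd (fun u => abs_colH_le_const (N := N) hK' hδK μ y κ u) (fun u => hT κ u) hδ x z a b)
    (fun κ x z a b => summable_wsumTerm_bdd (fun u => abs_colH_le_const (N := N) hK' hδK μ y κ u) (fun u => hT' κ u) hδ x z a b)

/-- [folklore] A kernel bi-localised with a far-decaying constant `C·e^{−δ′t}` (`t ≥ 0`) is bi-localised with the constant `C`. -/
theorem biLoc_of_far {K : MKer (d + 1) (Fib d)} {p q : Fin (d + 1) → ℤ} {C δ δ' t : ℝ} (h : BiLoc K p q (C * Real.exp (-δ' * t)) δ)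
    (hC : 0 ≤ C) (hδ' : 0 ≤ δ') (ht : 0 ≤ t) : BiLoc K p q C δ := by
  intro x z a b
  refine (h x z a b).trans ?_
  have hexp : Real.exp (-δ' * t) ≤ 1 := Real.exp_le_one_iff.2 (by nlinarith)
  have hE := (Real.exp_pos (-δ * (l1 (x - p) + l1 (z - q)))).le
  calc C * Real.exp (-δ' * t) * Real.exp (-δ * (l1 (x - p) + l1 (z - q)))
      ≤ C * 1 * Real.exp (-δ * (l1 (x - p) + l1 (z - q))) := by gcongr
    _ = C * Real.exp (-δ * (l1 (x - p) + l1 (z - q))) := by rw [mul_one]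

/-- [folklore] **THE INNER CHAIN-RULE VERTEX OF A SLICE TELESCOPES** — decaying kernels, tables bi-localised at a FIXED fine bond `u` with
constants decaying in their own index (the `u`-slices `u′ ↦ S₂ κ u κ′ u′` of a `LocStencil₂` family):
`vertexOfK K N (S₂ κ u) ν y′ − vertexOfK K′ N (S₂′ κ u) ν y′ = vertexOfK (K − K′) N (S₂ κ u) ν y′ + vertexOfK K′ N ((S₂ − S₂′) κ u) ν y′`. -/
theorem vertexOfK_sub_of_ctr {K K' : MKer (d + 1) (Fib d)} {C C' δK : ℝ} (hK : Decays K C δK) (hK' : Decays K' C' δK)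
    (hδK : 0 ≤ δK) {T T' : Fin (d + 1) → (Fin (d + 1) → ℤ) → MKer (d + 1) (Fib d)} {u : Fin (d + 1) → ℤ} {B B' δ δ' : ℝ}
    (hT : ∀ κ' u', BiLoc (T κ' u') u u (B * Real.exp (-δ * l1 (u' - u))) δ')
    (hT' : ∀ κ' u', BiLoc (T' κ' u') u u (B' * Real.exp (-δ * l1 (u' - u))) δ') (hδ : 0 < δ) (hδ' : 0 ≤ δ') (hB : 0 ≤ B) (hB' : 0 ≤ B')
    (ν : Fin (d + 1)) (y' : Fin (d + 1) → ℤ) :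
    vertexOfK K N T ν y' - vertexOfK K' N T' ν y' = vertexOfK (K - K') N T ν y' + vertexOfK K' N (T - T') ν y' :=
  vertexOfK_sub_vertexOfK
    (fun κ' x z a b => summable_wsumTerm_ctr (fun u' => abs_colH_le_const (N := N) hK hδK ν y' κ' u') (fun u' => hT κ' u') hδ hδ' hB
      x z a b)
    (fun κ' x z a b => summable_wsumTerm_ctr (fun u' => abs_colH_le_const (N := N) hK' hδK ν y' κ' u') (fun u' => hT κ' u') hδ hδ' hB
      x z a b)
    (fun κ' x z a b => summable_wsumTerm_ctr (fun u' => abs_colH_le_const (N := N) hK' hδK ν y' κ' u') (fun u' => hT' κ' u') hδ hδ' hB'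
      x z a b)

/-- [folklore] **THE MULTIPLIER-COLUMN VERTEX IS LINEAR IN THE KERNEL, UNDER SUMMABILITY** (table fixed):
`vertexOfM K N Q μ y − vertexOfM K′ N Q μ y = vertexOfM (K − K′) N Q μ y`. -/
theorem vertexOfM_sub_vertexOfM {K K' : MKer (d + 1) (Fib d)} {Q : Fin (d + 1) → (Fin (d + 1) → ℤ) → MKer (d + 1) (Fib d)}
    {μ : Fin (d + 1)} {y : Fin (d + 1) → ℤ}
    (h1 : ∀ ρ x z a b, Summable fun v => onLat N (colM K N μ y ρ) v * onLat N (Q ρ) v x z a b)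
    (h2 : ∀ ρ x z a b, Summable fun v => onLat N (colM K' N μ y ρ) v * onLat N (Q ρ) v x z a b) :
    vertexOfM K N Q μ y - vertexOfM K' N Q μ y = vertexOfM (K - K') N Q μ y := by
  funext x z a b
  simp only [vertexOfM, Pi.sub_apply]
  rw [← Finset.sum_sub_distrib]
  refine Finset.sum_congr rfl fun ρ _ => ?_
  simp only [cwsum, wsum]
  rw [← (h1 ρ x z a b).tsum_sub (h2 ρ x z a b)]
  refine tsum_congr fun v => ?_
  by_cases hv : Torus.proj N v = 0
  · simp only [onLat, hv, if_true, colM, Pi.sub_apply]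
    ring
  · simp only [onLat, hv, if_false]
    ring

/-- [folklore] **THE MULTIPLIER-COLUMN VERTEX IS LINEAR IN THE KERNEL** — decaying kernels, a table localised at the coarse bonds
(`VertexFamily`, an2's `M1`-type tables). -/
theorem vertexOfM_sub_of_decays [NeZero N] {K K' : MKer (d + 1) (Fib d)} {C C' δK : ℝ} (hK : Decays K C δK) (hK' : Decays K' C' δK)
    (hδK : 0 ≤ δK) {M : Fin (d + 1) → (Fin (d + 1) → ℤ) → MKer (d + 1) (Fib d)} {CM δ : ℝ} (hM : VertexFamily M N CM δ) (hδ : 0 < δ)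
    (μ : Fin (d + 1)) (y : Fin (d + 1) → ℤ) :
    vertexOfM K N M μ y - vertexOfM K' N M μ y = vertexOfM (K - K') N M μ y :=
  vertexOfM_sub_vertexOfM
    (fun ρ x z a b => summable_wsumTerm_bdd (fun v => abs_onLat_colM_le_const (N := N) hK hδK μ y ρ v)
      (fun v => onLat_biLoc (fun w => hM ρ w) v) hδ x z a b)
    (fun ρ x z a b => summable_wsumTerm_bdd (fun v => abs_onLat_colM_le_const (N := N) hK' hδK μ y ρ v)
      (fun v => onLat_biLoc (fun w => hM ρ w) v) hδ x z a b)

/-- [folklore] **THE MULTIPLIER-COLUMN VERTEX IS LINEAR IN THE KERNEL** — kernels bi-localised at coarse points, `VertexFamily` table. -/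
theorem vertexOfM_sub_of_biLoc [NeZero N] {K K' : MKer (d + 1) (Fib d)} {q q' : Fin (d + 1) → ℤ} {C C' δK : ℝ} (hK : BiLoc K q q C δK)
    (hK' : BiLoc K' q' q' C' δK) (hδK : 0 ≤ δK) {M : Fin (d + 1) → (Fin (d + 1) → ℤ) → MKer (d + 1) (Fib d)} {CM δ : ℝ}
    (hM : VertexFamily M N CM δ) (hδ : 0 < δ) (μ : Fin (d + 1)) (y : Fin (d + 1) → ℤ) :
    vertexOfM K N M μ y - vertexOfM K' N M μ y = vertexOfM (K - K') N M μ y :=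
  vertexOfM_sub_vertexOfM
    (fun ρ x z a b => summable_wsumTerm_bdd (fun v => abs_onLat_colM_le_const_of_biLoc (N := N) hK hδK μ y ρ v)
      (fun v => onLat_biLoc (fun w => hM ρ w) v) hδ x z a b)
    (fun ρ x z a b => summable_wsumTerm_bdd (fun v => abs_onLat_colM_le_const_of_biLoc (N := N) hK' hδK μ y ρ v)
      (fun v => onLat_biLoc (fun w => hM ρ w) v) hδ x z a b)

/-- [folklore] **THE MULTIPLIER-COLUMN VERTEX OF A MIXED SLICE IS LINEAR IN THE KERNEL** — decaying kernels, the `u`-slice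
`w ↦ M₂ κ u ρ w` of a local field–multiplier table (`LocStencilFM`, rate `δ > 0`). -/
theorem vertexOfM_sub_of_ctr [NeZero N] {K K' : MKer (d + 1) (Fib d)} {C C' δK : ℝ} (hK : Decays K C δK) (hK' : Decays K' C' δK)
    (hδK : 0 ≤ δK) {Q : Fin (d + 1) → (Fin (d + 1) → ℤ) → MKer (d + 1) (Fib d)} {u : Fin (d + 1) → ℤ} {B δ : ℝ}
    (hQ : ∀ ρ w, BiLoc (Q ρ w) u u (B * Real.exp (-δ * l1 (u - (N : ℤ) • w))) δ) (hδ : 0 < δ) (hB : 0 ≤ B)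
    (ν : Fin (d + 1)) (y' : Fin (d + 1) → ℤ) :
    vertexOfM K N Q ν y' - vertexOfM K' N Q ν y' = vertexOfM (K - K') N Q ν y' :=
  vertexOfM_sub_vertexOfM
    (fun ρ x z a b => summable_wsumTerm_ctr (fun v => abs_onLat_colM_le_const (N := N) hK hδK ν y' ρ v)
      (fun v => onLat_biLoc_ctr (fun w => hQ ρ w) hB v) hδ hδ.le hB x z a b)
    (fun ρ x z a b => summable_wsumTerm_ctr (fun v => abs_onLat_colM_le_const (N := N) hK' hδK ν y' ρ v)
      (fun v => onLat_biLoc_ctr (fun w => hQ ρ w) hB v) hδ hδ.le hB x z a b)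

/-- [folklore] **THE OPERATOR DERIVATIVE `dM` TELESCOPES** (multiplier table fixed): decaying kernels, local stencil tables, a
`VertexFamily` multiplier table ⇒ `dM K N S M μ y − dM K′ N S′ M μ y = dM (K − K′) N S M μ y + vertexOfK K′ N (S − S′) μ y`. -/
theorem dM_sub_of_decays [NeZero N] {K K' : MKer (d + 1) (Fib d)} {C C' δK : ℝ} (hK : Decays K C δK) (hK' : Decays K' C' δK)
    (hδK : 0 ≤ δK) {S S' : Fin (d + 1) → (Fin (d + 1) → ℤ) → MKer (d + 1) (Fib d)} {Cs Cs' δ : ℝ} (hS : LocStencil S Cs δ)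
    (hS' : LocStencil S' Cs' δ) {M : Fin (d + 1) → (Fin (d + 1) → ℤ) → MKer (d + 1) (Fib d)} {CM : ℝ} (hM : VertexFamily M N CM δ)
    (hδ : 0 < δ) (μ : Fin (d + 1)) (y : Fin (d + 1) → ℤ) :
    dM K N S M μ y - dM K' N S' M μ y = dM (K - K') N S M μ y + vertexOfK K' N (S - S') μ y := by
  have h1 := vertexOfK_sub_of_decays (N := N) hK hK' hδK hS hS' hδ μ y
  have h2 := vertexOfM_sub_of_decays (N := N) hK hK' hδK hM hδ μ y
  simp only [dM]
  rw [show vertexOfK K N S μ y + vertexOfM K N M μ y - (vertexOfK K' N S' μ y + vertexOfM K' N M μ y)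
      = (vertexOfK K N S μ y - vertexOfK K' N S' μ y) + (vertexOfM K N M μ y - vertexOfM K' N M μ y) by abel, h1, h2]
  abel

/-- [folklore] **`dM` OVER BI-LOCALISED KERNELS TELESCOPES** (the second-response kernels `K2OfK … ν y′`, multiplier table fixed). -/
theorem dM_sub_of_biLoc [NeZero N] {K K' : MKer (d + 1) (Fib d)} {q q' : Fin (d + 1) → ℤ} {C C' δK : ℝ} (hK : BiLoc K q q C δK)
    (hK' : BiLoc K' q' q' C' δK) (hδK : 0 ≤ δK) {S S' : Fin (d + 1) → (Fin (d + 1) → ℤ) → MKer (d + 1) (Fib d)} {Cs Cs' δ : ℝ}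
    (hS : LocStencil S Cs δ) (hS' : LocStencil S' Cs' δ) {M : Fin (d + 1) → (Fin (d + 1) → ℤ) → MKer (d + 1) (Fib d)} {CM : ℝ}
    (hM : VertexFamily M N CM δ) (hδ : 0 < δ) (μ : Fin (d + 1)) (y : Fin (d + 1) → ℤ) :
    dM K N S M μ y - dM K' N S' M μ y = dM (K - K') N S M μ y + vertexOfK K' N (S - S') μ y := by
  have h1 := vertexOfK_sub_of_biLoc (N := N) hK hK' hδK hS hS' hδ μ y
  have h2 := vertexOfM_sub_of_biLoc (N := N) hK hK' hδK hM hδ μ y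
  simp only [dM]
  rw [show vertexOfK K N S μ y + vertexOfM K N M μ y - (vertexOfK K' N S' μ y + vertexOfM K' N M μ y)
      = (vertexOfK K N S μ y - vertexOfK K' N S' μ y) + (vertexOfM K N M μ y - vertexOfM K' N M μ y) by abel, h1, h2]
  abel

end Summit.QuantumFields.BalabanUV.Beta.GAN24.WSlotCarrierSub

end
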